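import Literature.NumberTheory.EllipticCurves.NeronComponentIndexTypeI0starExactProofs
import Literature.NumberTheory.EllipticCurves.Kramer1981.FiniteFieldTwoTorsionDiscriminant
import Literature.NumberTheory.EllipticCurves.TwoTorsionOddDegreeBaseChangeProofs
import Literature.NumberTheory.EllipticCurves.GlobalMinimalModelProofs
import Literature.NumberTheory.EllipticCurves.QuadraticTwist
import Mathlib.NumberTheory.Padics.RingHoms
import Mathlib.NumberTheory.LegendreSymbol.JacobiSymbol
import HarnessLib

/-!
# The Tamagawa number of a quadratic twist at an odd good prime `q ∥ d`:
# `c_q(E^{(d)}) = 1 + #{roots of the 2-division cubic of E mod q} = #Ẽ(𝔽_q)[2]` (proofs)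

`Proofs` file (theorems only: no definition, no named fact, no instance), topic
`Literature/NumberTheory/EllipticCurves`, namespace `Literature.NumberTheory.EllipticCurves.TwistIstar`.

Let `W/ℚ` be a globally minimal Weierstrass equation with integer model `M = integralModelInt W`,
`q` an ODD prime of good reduction (`q ∤ Δ_min`), and `d ∈ ℤ` with `q ∥ d`, `d = q·d₁`. For ANY
equation `Wd = Cd • W^{(d)}` of the quadratic twist:

* §1 `smul_half_quadraticTwist_eq_map` — the tree's twist `W^{(d)} = (0, d b₂/4, 0, d² b₄/2, d³ b₆/4)`
  (`QuadraticTwist.lean`) rescaled by `u = ½` is the INTEGER equation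
  `J = (0, d b₂, 0, 8 d² b₄, 16 d³ b₆)` (`b_i` of `M`); `Δ(J) = 2¹² d⁶ Δ(M)` (`Δ_twistModelInt`);
* §2 `localTamagawaNumber_padic_twist_eq_model` — `c_q(Wd) = c_q(J ⊗ ℤ_q)` (model independence of
  the local Tamagawa number, Silverman *AEC* VII.6 Ex. 7.6);
* §3 at `q ∥ d`: `J ⊗ ℤ_q` is the Step-6 normal form `y² = x³ + qβx² + q²δx + q³ε` with
  `β = d₁b₂`, `δ = 8d₁²b₄`, `ε = 16d₁³b₆`, minimal (`v_q Δ = 6 < 12`), and the discriminant of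
  `P(T) = T³ + βT² + δT + ε` is `2⁸ d₁⁶ Δ(M)`, a `q`-unit; by the tree's exact `I₀*` count
  (`LocalIndex.localTamagawaNumber_baseChange_eq_one_add_card_roots`, Silverman *ATAEC* IV.9.4
  Step 6) **`c_q(Wd) = 1 + #{t ∈ 𝔽_q : P̄(t) = 0}`**, and `P(4d₁x) = 16d₁³·ψ(x)` with
  `ψ = 4x³ + b₂x² + 2b₄x + b₆` the `2`-division cubic of `M`, so
  **`c_q(Wd) = 1 + #{x ∈ 𝔽_q : ψ̄(x) = 0}`** (`localTamagawaNumber_padic_twist_eq_one_add_card`) —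
  Boxer–Diao 2010, proof of Prop. 4.1 (p. 1977): "`c_p` is equal to `1` plus the number of roots of
  the polynomial … mod `p`, which is the same as the number of `2`-torsion of `E` mod `p`";
  Kramer 1981, Prop. 3;
* §4 `padicValNat_two_one_add_card_roots` — the `2`-ADIC DICTIONARY: with `ρ = #{x : ψ̄(x) = 0}`
  (`0`, `1` or `3`), `ord₂(1 + ρ) = [(Δ_min/q) = −1] + 2·[(Δ_min/q) = +1 ∧ a_q even]`
  (`ρ = 1` iff the discriminant `16Δ` of `ψ̄` is a non-square — Kramer 1981 p. 125, tree
  `Kramer1981.exists_natCard_torsionBy_two_eq_two_pow`; `ρ ≥ 1` iff `Ẽ(𝔽_q)` has a point of order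
  `2` iff `#Ẽ(𝔽_q) = q + 1 − a_q` is even);
* §5 `padicValNat_two_localTamagawaNumber_twist_of_dvd` — hence
  **`ord₂ c_q(Wd) = [(Δ_min/q) = −1] + 2·[(Δ_min/q) = 1 ∧ 2 ∣ a_q(W)]`**.

Motivation: the Tamagawa bookkeeping `DoorTwistTamagawaAtTwo` of the BSD route
`ByReductionTypeAtTwo` (crux `RankOneAtTwoBigImageOddLocal`, line `one_door_law`), whose door
twists `E^{(d)}`, `d ≡ 1 (mod 8)` with all `q ∣ d` good, have type `I₀*` at every `q ∣ d` with
`c_q ∈ {1, 2, 4}` read off the Frobenius class of `q` on `E[2]`.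

## References

* G. Boxer, P. Diao, *2-Selmer groups of quadratic twists of elliptic curves*, Proc. Amer. Math.
  Soc. 138 (2010) 1969–1978, proof of Prop. 4.1 (p. 1977). [BoxerDiao2010]
* K. Kramer, *Arithmetic of elliptic curves upon quadratic extension*, Trans. Amer. Math. Soc. 264
  (1981), Prop. 3 and its proof (p. 125). [Kramer1981]
* J. H. Silverman, *The Arithmetic of Elliptic Curves*, 2nd ed. (2009), III.1, VII.1 Rem. 1.1,
  VII.6 Ex. 7.6, X.5 Cor. 5.4. [SilvermanAEC2009]
* J. H. Silverman, *Advanced Topics in the Arithmetic of Elliptic Curves* (1994), IV.9.4 Step 6.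
  [SilvermanATAEC1994]
-/

noncomputable section

open scoped Classical

open IsLocalRing Polynomial WeierstrassCurve

namespace Literature.NumberTheory.EllipticCurves

namespace TwistIstar

/-! ### §1 The integer equation `J = (0, d b₂, 0, 8 d² b₄, 16 d³ b₆)` of the twist -/

section IntegerModel

/-- `Δ(0, dB₂, 0, 8d²B₄, 16d³B₆) = 2¹² d⁶ Δ(M)` for `B_i = b_i(M)` (the twist rescaled by `u = ½`
multiplies `Δ` by `2¹²`, and `Δ(E^{(d)}) = d⁶Δ(E)`, Silverman *AEC* III.1 Table 3.1, X.5).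
[cite: SilvermanAEC2009, III.1 Table 3.1] -/
theorem Δ_twistModelInt {S : Type*} [CommRing S] (M : WeierstrassCurve S) (d : S) :
    (⟨0, d * M.b₂, 0, 8 * d ^ 2 * M.b₄, 16 * d ^ 3 * M.b₆⟩ : WeierstrassCurve S).Δ =
      2 ^ 12 * d ^ 6 * M.Δ := by
  simp only [WeierstrassCurve.Δ, WeierstrassCurve.b₂, WeierstrassCurve.b₄, WeierstrassCurve.b₆,
    WeierstrassCurve.b₈]
  ring

/-- The discriminant of the Step-6 cubic `T³ + e b₂ T² + 8e² b₄ T + 16 e³ b₆` is `2⁸ e⁶ Δ(M)`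
(`Δ = 16 · disc` for `y² = cubic`, Silverman *AEC* III.1). [cite: SilvermanAEC2009, III.1 (b₂, b₄, b₆, b₈ and Δ)] -/
theorem cubicDiscr_twistModelInt {S : Type*} [CommRing S] (M : WeierstrassCurve S) (e : S) :
    (e * M.b₂) ^ 2 * (8 * e ^ 2 * M.b₄) ^ 2 - 4 * (8 * e ^ 2 * M.b₄) ^ 3 -
        4 * (e * M.b₂) ^ 3 * (16 * e ^ 3 * M.b₆) - 27 * (16 * e ^ 3 * M.b₆) ^ 2 +
        18 * (e * M.b₂) * (8 * e ^ 2 * M.b₄) * (16 * e ^ 3 * M.b₆) =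
      2 ^ 8 * e ^ 6 * M.Δ := by
  simp only [WeierstrassCurve.Δ, WeierstrassCurve.b₂, WeierstrassCurve.b₄, WeierstrassCurve.b₆,
    WeierstrassCurve.b₈]
  ring

/-- `P(4ex) = 16e³ · ψ(x)` for the Step-6 cubic `P(T) = T³ + e b₂ T² + 8e² b₄ T + 16 e³ b₆` and
the `2`-division cubic `ψ(x) = 4x³ + b₂x² + 2b₄x + b₆` (Boxer–Diao 2010, proof of Prop. 4.1:
the roots of the Step-6 cubic "[are] the same as the number of `2`-torsion of `E` mod `p`").
[cite: BoxerDiao2010, proof of Prop. 4.1 (p. 1977)] -/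
theorem cubic_rescale {S : Type*} [CommRing S] (e B₂ B₄ B₆ x : S) :
    (4 * e * x) ^ 3 + e * B₂ * (4 * e * x) ^ 2 + 8 * e ^ 2 * B₄ * (4 * e * x) + 16 * e ^ 3 * B₆ =
      16 * e ^ 3 * (4 * x ^ 3 + B₂ * x ^ 2 + 2 * B₄ * x + B₆) := by
  ring

variable (W : WeierstrassCurve ℚ) [W.IsGloballyMinimal]

/-- **`W^{(d)}` rescaled by `u = ½` is the integer equation `J = (0, d b₂, 0, 8d²b₄, 16d³b₆)`**
(`b_i` of the integer model `M = integralModelInt W`): the tree's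
`W^{(d)} = (0, d b₂/4, 0, d² b₄/2, d³ b₆/4)` (`QuadraticTwist.lean`) and Silverman *AEC* III.1
Table 3.1 (`u⁻ⁱ aᵢ`). [cite: SilvermanAEC2009, III.1 Table 3.1] -/
theorem smul_half_quadraticTwist_eq_map (d : ℤ) :
    (⟨Units.mk0 (2⁻¹ : ℚ) (by norm_num), 0, 0, 0⟩ : VariableChange ℚ) • W.quadraticTwist (d : ℚ) =
      (⟨0, d * (integralModelInt W).b₂, 0, 8 * d ^ 2 * (integralModelInt W).b₄,
          16 * d ^ 3 * (integralModelInt W).b₆⟩ : WeierstrassCurve ℤ).map (Int.castRingHom ℚ) := by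
  have hW : W = (integralModelInt W).map (Int.castRingHom ℚ) := (map_integralModelInt W).symm
  set M := integralModelInt W with hM
  have hb₂ : W.b₂ = (M.b₂ : ℚ) := by
    have e := congrArg WeierstrassCurve.b₂ hW; rwa [map_b₂, eq_intCast] at e
  have hb₄ : W.b₄ = (M.b₄ : ℚ) := by
    have e := congrArg WeierstrassCurve.b₄ hW; rwa [map_b₄, eq_intCast] at e
  have hb₆ : W.b₆ = (M.b₆ : ℚ) := by
    have e := congrArg WeierstrassCurve.b₆ hW; rwa [map_b₆, eq_intCast] at e
  ext
  · simp [variableChange_a₁]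
  · simp only [variableChange_a₂, quadraticTwist_a₁, quadraticTwist_a₂, hb₂, map_a₂, eq_intCast,
      Units.val_inv_eq_inv_val, Units.val_mk0, inv_inv, Int.cast_mul]
    field_simp
    ring
  · simp [variableChange_a₃]
  · simp only [variableChange_a₄, quadraticTwist_a₁, quadraticTwist_a₂, quadraticTwist_a₃,
      quadraticTwist_a₄, hb₄, map_a₄, eq_intCast, Units.val_inv_eq_inv_val, Units.val_mk0, inv_inv,
      Int.cast_mul, Int.cast_pow, Int.cast_ofNat]
    field_simp
    ring
  · simp only [variableChange_a₆, quadraticTwist_a₁, quadraticTwist_a₂, quadraticTwist_a₃,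
      quadraticTwist_a₄, quadraticTwist_a₆, hb₆, map_a₆, eq_intCast, Units.val_inv_eq_inv_val,
      Units.val_mk0, inv_inv, Int.cast_mul, Int.cast_pow, Int.cast_ofNat]
    field_simp
    ring

end IntegerModel

/-! ### §2 `c_q(Wd) = c_q(J ⊗ ℤ_q)` -/

section Local

variable (W : WeierstrassCurve ℚ) [W.IsElliptic] [W.IsGloballyMinimal] {d : ℤ} (hd0 : d ≠ 0)
  {Wd : WeierstrassCurve ℚ} (Cd : VariableChange ℚ) (hWd : Cd • W.quadraticTwist (d : ℚ) = Wd)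

include hd0 hWd

/-- **`c_q(Wd) = c_q(J)`** for any equation `Wd = Cd • W^{(d)}` of the twist and the integer equation
`J = (0, d b₂, 0, 8d²b₄, 16d³b₆)` read in `ℤ_q` (model independence of the local Tamagawa number,
Silverman *AEC* VII.6 Ex. 7.6 with VII.1 Prop. 1.3(b); `smul_half_quadraticTwist_eq_map`).
[cite: SilvermanAEC2009, VII.6 Ex. 7.6 with VII.1 Prop. 1.3(b)] -/
theorem localTamagawaNumber_padic_twist_eq_model (q : ℕ) [Fact q.Prime] :
    (Wd.baseChange ℚ_[q]).localTamagawaNumber ℤ_[q] =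
      (((⟨0, d * (integralModelInt W).b₂, 0, 8 * d ^ 2 * (integralModelInt W).b₄,
          16 * d ^ 3 * (integralModelInt W).b₆⟩ : WeierstrassCurve ℤ).map
        (Int.castRingHom ℤ_[q])).baseChange ℚ_[q]).localTamagawaNumber ℤ_[q] := by
  set J : WeierstrassCurve ℤ := ⟨0, d * (integralModelInt W).b₂, 0,
    8 * d ^ 2 * (integralModelInt W).b₄, 16 * d ^ 3 * (integralModelInt W).b₆⟩ with hJ
  set C₂ : VariableChange ℚ := ⟨Units.mk0 (2⁻¹ : ℚ) (by norm_num), 0, 0, 0⟩ with hC₂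
  have hdq : (d : ℚ) ≠ 0 := by exact_mod_cast hd0
  haveI : (W.quadraticTwist (d : ℚ)).IsElliptic := W.isElliptic_quadraticTwist hdq
  haveI hXe : ((W.quadraticTwist (d : ℚ)).baseChange ℚ_[q]).IsElliptic := by
    unfold baseChange; infer_instance
  have hJq : C₂ • W.quadraticTwist (d : ℚ) = J.map (Int.castRingHom ℚ) :=
    smul_half_quadraticTwist_eq_map W d
  -- `Wd ⊗ ℚ_q = Cd • (W^{(d)} ⊗ ℚ_q)`
  have e1 : Wd.baseChange ℚ_[q] =
      Cd.map (algebraMap ℚ ℚ_[q]) • (W.quadraticTwist (d : ℚ)).baseChange ℚ_[q] := by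
    rw [← hWd, baseChange, baseChange, map_variableChange]
  -- `W^{(d)} ⊗ ℚ_q = C₂⁻¹ • (J ⊗ ℚ_q)`
  have hX : W.quadraticTwist (d : ℚ) = C₂⁻¹ • J.map (Int.castRingHom ℚ) :=
    eq_inv_smul_iff.mpr hJq
  have hφ : (algebraMap ℚ ℚ_[q]).comp (Int.castRingHom ℚ) =
      (algebraMap ℤ_[q] ℚ_[q]).comp (Int.castRingHom ℤ_[q]) := RingHom.ext_int _ _
  have e2 : (W.quadraticTwist (d : ℚ)).baseChange ℚ_[q] =
      (C₂⁻¹).map (algebraMap ℚ ℚ_[q]) • (J.map (Int.castRingHom ℤ_[q])).baseChange ℚ_[q] := by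
    rw [hX, baseChange, ← map_variableChange, baseChange, WeierstrassCurve.map_map,
      WeierstrassCurve.map_map, hφ]
  haveI : ((J.map (Int.castRingHom ℤ_[q])).baseChange ℚ_[q]).IsElliptic := by
    rw [WeierstrassCurve.isElliptic_iff]
    have h := ((W.quadraticTwist (d : ℚ)).baseChange ℚ_[q]).isUnit_Δ
    rw [e2, variableChange_Δ] at h
    exact isUnit_of_mul_isUnit_right h
  rw [e1, localTamagawaNumber_variableChange_holds, e2, localTamagawaNumber_variableChange_holds]

end Local

/-! ### §3 At a prime `q ∥ d` of good reduction: type `I₀*`, `c_q(Wd) = 1 + #roots` -/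

section DoorPrime

/-- An integer prime to `p` is a unit of `ℤ_p`. [folklore] -/
private theorem isUnit_intCast_padicInt_of_not_dvd {p : ℕ} [Fact p.Prime] {z : ℤ}
    (h : ¬ (p : ℤ) ∣ z) : IsUnit ((z : ℤ) : ℤ_[p]) := by
  rw [PadicInt.isUnit_iff]
  by_contra hne
  have hlt : ‖((z : ℤ) : ℤ_[p])‖ < 1 := lt_of_le_of_ne (PadicInt.norm_le_one _) hne
  rw [PadicInt.norm_int_lt_one_iff_dvd] at hlt
  exact h hlt

/-- An integer prime to `p` is non-zero in `ZMod p`-valued residue arithmetic: `(z : ZMod p) ≠ 0`.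
[folklore] -/
private theorem intCast_zmod_ne_zero {p : ℕ} [Fact p.Prime] {z : ℤ} (h : ¬ (p : ℤ) ∣ z) :
    (z : ZMod p) ≠ 0 := by
  rwa [Ne, ZMod.intCast_zmod_eq_zero_iff_dvd]

variable (W : WeierstrassCurve ℚ) [W.IsElliptic] [W.IsGloballyMinimal] (q : ℕ) [hq : Fact q.Prime]
  (hq2 : q ≠ 2) (hqΔ : ¬ (q : ℤ) ∣ minimalDiscriminantInt W) {d d₁ : ℤ} (hd : d = q * d₁)
  (hqd₁ : ¬ (q : ℤ) ∣ d₁) {Wd : WeierstrassCurve ℚ} (Cd : VariableChange ℚ)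
  (hWd : Cd • W.quadraticTwist (d : ℚ) = Wd)

include hq2 hqΔ hd hqd₁ hWd

/-- **`c_q(Wd) = 1 + #{t ∈ k : P̄(t) = 0}` at a good odd prime `q ∥ d`, `d = q d₁`**, with
`P(T) = T³ + d₁b₂ T² + 8d₁²b₄ T + 16d₁³b₆` (`b_i` of the integer minimal model) read in the residue
field `k` of `ℤ_q`: the integer equation `J = (0, d b₂, 0, 8d²b₄, 16d³b₆)` of the twist is the
Step-6 normal form `y² = x³ + qβx² + q²δx + q³ε` (`β = d₁b₂`, `δ = 8d₁²b₄`, `ε = 16d₁³b₆`),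
minimal at `q` (`v_q Δ(J) = v_q(2¹²d⁶Δ_min) = 6 < 12`), `disc P = 2⁸d₁⁶Δ_min` is a `q`-unit
(type `I₀*`), and the tree's exact count `LocalIndex.localTamagawaNumber_baseChange_eq_one_add_card_roots`
applies. Boxer–Diao 2010, proof of Prop. 4.1 (p. 1977): "`c_p` is equal to `1` plus the number of
roots of the polynomial … mod `p`". [cite: BoxerDiao2010, proof of Prop. 4.1 (p. 1977)]
[cite: SilvermanATAEC1994, IV.9.4 Step 6 (PDF p. 345)] -/
theorem localTamagawaNumber_padic_twist_eq_one_add_card_roots :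
    (Wd.baseChange ℚ_[q]).localTamagawaNumber ℤ_[q] =
      1 + (X ^ 3 + C (residue ℤ_[q] ((d₁ : ℤ_[q]) * ((integralModelInt W).b₂ : ℤ_[q]))) * X ^ 2 +
            C (residue ℤ_[q] (8 * (d₁ : ℤ_[q]) ^ 2 * ((integralModelInt W).b₄ : ℤ_[q]))) * X +
            C (residue ℤ_[q] (16 * (d₁ : ℤ_[q]) ^ 3 * ((integralModelInt W).b₆ : ℤ_[q]))) :
          (ResidueField ℤ_[q])[X]).roots.toFinset.card := by
  have hqP : q.Prime := hq.out
  have hq' : Prime (q : ℤ) := Nat.prime_iff_prime_int.mp hqP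
  have h2 : ¬ (q : ℤ) ∣ 2 := fun h => by
    have : q ∣ 2 := by exact_mod_cast h
    exact hq2 ((Nat.prime_dvd_prime_iff_eq hqP Nat.prime_two).mp this)
  have hd0 : d ≠ 0 := by
    rw [hd]
    exact mul_ne_zero hq'.ne_zero fun h => hqd₁ (h ▸ dvd_zero _)
  set M := integralModelInt W with hM
  have hΔM : minimalDiscriminantInt W = M.Δ := rfl
  rw [localTamagawaNumber_padic_twist_eq_model W hd0 Cd hWd q]
  set J : WeierstrassCurve ℤ := ⟨0, d * M.b₂, 0, 8 * d ^ 2 * M.b₄, 16 * d ^ 3 * M.b₆⟩ with hJ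
  set N : WeierstrassCurve ℤ_[q] := J.map (Int.castRingHom ℤ_[q]) with hN
  -- the Step-6 shape
  have s1 : N.a₁ = 0 := by simp [hN, hJ]
  have s2 : N.a₂ = (q : ℤ_[q]) * ((d₁ : ℤ_[q]) * (M.b₂ : ℤ_[q])) := by
    simp only [hN, hJ, map_a₂, eq_intCast, hd, Int.cast_mul, Int.cast_natCast]; ring
  have s3 : N.a₃ = 0 := by simp [hN, hJ]
  have s4 : N.a₄ = (q : ℤ_[q]) ^ 2 * (8 * (d₁ : ℤ_[q]) ^ 2 * (M.b₄ : ℤ_[q])) := by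
    simp only [hN, hJ, map_a₄, eq_intCast, hd, Int.cast_mul, Int.cast_pow, Int.cast_ofNat,
      Int.cast_natCast]; ring
  have s6 : N.a₆ = (q : ℤ_[q]) ^ 3 * (16 * (d₁ : ℤ_[q]) ^ 3 * (M.b₆ : ℤ_[q])) := by
    simp only [hN, hJ, map_a₆, eq_intCast, hd, Int.cast_mul, Int.cast_pow, Int.cast_ofNat,
      Int.cast_natCast]; ring
  -- `Δ(N) = q⁶ · unit`, so `N ⊗ ℚ_q` is minimal and elliptic
  have hu : IsUnit (((2 ^ 12 * d₁ ^ 6 * M.Δ : ℤ)) : ℤ_[q]) := by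
    refine isUnit_intCast_padicInt_of_not_dvd fun h => ?_
    rcases hq'.dvd_or_dvd h with h | h
    · rcases hq'.dvd_or_dvd h with h | h
      · exact h2 (hq'.dvd_of_dvd_pow h)
      · exact hqd₁ (hq'.dvd_of_dvd_pow h)
    · exact hqΔ (hΔM ▸ h)
  have hΔeq : N.Δ = (q : ℤ_[q]) ^ 6 * (((2 ^ 12 * d₁ ^ 6 * M.Δ : ℤ)) : ℤ_[q]) := by
    have e : N.Δ = ((2 ^ 12 * d ^ 6 * M.Δ : ℤ) : ℤ_[q]) := by
      rw [hN, map_Δ, hJ, Δ_twistModelInt, eq_intCast]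
    rw [e, hd]; push_cast; ring
  haveI : WeierstrassCurve.IsIntegral ℤ_[q] (N.baseChange ℚ_[q]) := ⟨⟨_, rfl⟩⟩
  have hval : (IsDiscreteValuationRing.maximalIdeal ℤ_[q]).valuation ℚ_[q] (N.baseChange ℚ_[q]).Δ =
      WithZero.exp (-(6 : ℕ) : ℤ) := by
    rw [WeierstrassCurve.baseChange, WeierstrassCurve.map_Δ, hΔeq]
    exact LocalIndex.valuation_algebraMap_pow_mul_of_isUnit PadicInt.irreducible_p hu 6
  haveI : (N.baseChange ℚ_[q]).IsMinimal ℤ_[q] :=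
    WeierstrassCurve.isMinimal_of_exp_lt_valuation_Δ _ (by rw [hval, WithZero.exp_lt_exp]; norm_num)
  have hΔK : (N.baseChange ℚ_[q]).Δ ≠ 0 := by
    rw [WeierstrassCurve.baseChange, WeierstrassCurve.map_Δ, hΔeq]
    exact (map_ne_zero_iff _ (IsFractionRing.injective ℤ_[q] ℚ_[q])).mpr
      (mul_ne_zero (pow_ne_zero _ PadicInt.irreducible_p.ne_zero) hu.ne_zero)
  haveI : (N.baseChange ℚ_[q]).IsElliptic := (WeierstrassCurve.isElliptic_iff _).mpr (Ne.isUnit hΔK)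
  haveI : HenselianLocalRing ℤ_[q] :=
    { is_henselian := fun f hf a₀ h₁ h₂ =>
        HenselianRing.is_henselian (I := IsLocalRing.maximalIdeal ℤ_[q]) f hf a₀ h₁ (h₂.map _) }
  -- the discriminant of the Step-6 cubic is the unit `2⁸ d₁⁶ Δ(M)`
  have hMb₂ : (M.map (Int.castRingHom ℤ_[q])).b₂ = (M.b₂ : ℤ_[q]) := by rw [map_b₂, eq_intCast]
  have hMb₄ : (M.map (Int.castRingHom ℤ_[q])).b₄ = (M.b₄ : ℤ_[q]) := by rw [map_b₄, eq_intCast]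
  have hMb₆ : (M.map (Int.castRingHom ℤ_[q])).b₆ = (M.b₆ : ℤ_[q]) := by rw [map_b₆, eq_intCast]
  have hdisc0 : ((d₁ : ℤ_[q]) * (M.b₂ : ℤ_[q])) ^ 2 * (8 * (d₁ : ℤ_[q]) ^ 2 * (M.b₄ : ℤ_[q])) ^ 2 -
      4 * (8 * (d₁ : ℤ_[q]) ^ 2 * (M.b₄ : ℤ_[q])) ^ 3 -
      4 * ((d₁ : ℤ_[q]) * (M.b₂ : ℤ_[q])) ^ 3 * (16 * (d₁ : ℤ_[q]) ^ 3 * (M.b₆ : ℤ_[q])) -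
      27 * (16 * (d₁ : ℤ_[q]) ^ 3 * (M.b₆ : ℤ_[q])) ^ 2 +
      18 * ((d₁ : ℤ_[q]) * (M.b₂ : ℤ_[q])) * (8 * (d₁ : ℤ_[q]) ^ 2 * (M.b₄ : ℤ_[q])) *
        (16 * (d₁ : ℤ_[q]) ^ 3 * (M.b₆ : ℤ_[q])) = ((2 ^ 8 * d₁ ^ 6 * M.Δ : ℤ) : ℤ_[q]) := by
    have h := cubicDiscr_twistModelInt (M.map (Int.castRingHom ℤ_[q])) (d₁ : ℤ_[q])
    rw [hMb₂, hMb₄, hMb₆, map_Δ, eq_intCast] at h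
    rw [h]; push_cast; ring
  have hudisc : IsUnit (((2 ^ 8 * d₁ ^ 6 * M.Δ : ℤ)) : ℤ_[q]) := by
    refine isUnit_intCast_padicInt_of_not_dvd fun h => ?_
    rcases hq'.dvd_or_dvd h with h | h
    · rcases hq'.dvd_or_dvd h with h | h
      · exact h2 (hq'.dvd_of_dvd_pow h)
      · exact hqd₁ (hq'.dvd_of_dvd_pow h)
    · exact hqΔ (hΔM ▸ h)
  have hdisc : residue ℤ_[q] ((d₁ : ℤ_[q]) * (M.b₂ : ℤ_[q])) ^ 2 *
        residue ℤ_[q] (8 * (d₁ : ℤ_[q]) ^ 2 * (M.b₄ : ℤ_[q])) ^ 2 -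
      4 * residue ℤ_[q] (8 * (d₁ : ℤ_[q]) ^ 2 * (M.b₄ : ℤ_[q])) ^ 3 -
      4 * residue ℤ_[q] ((d₁ : ℤ_[q]) * (M.b₂ : ℤ_[q])) ^ 3 *
        residue ℤ_[q] (16 * (d₁ : ℤ_[q]) ^ 3 * (M.b₆ : ℤ_[q])) -
      27 * residue ℤ_[q] (16 * (d₁ : ℤ_[q]) ^ 3 * (M.b₆ : ℤ_[q])) ^ 2 +
      18 * residue ℤ_[q] ((d₁ : ℤ_[q]) * (M.b₂ : ℤ_[q])) *
        residue ℤ_[q] (8 * (d₁ : ℤ_[q]) ^ 2 * (M.b₄ : ℤ_[q])) *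
        residue ℤ_[q] (16 * (d₁ : ℤ_[q]) ^ 3 * (M.b₆ : ℤ_[q])) ≠ 0 := by
    have e : residue ℤ_[q] (((d₁ : ℤ_[q]) * (M.b₂ : ℤ_[q])) ^ 2 *
        (8 * (d₁ : ℤ_[q]) ^ 2 * (M.b₄ : ℤ_[q])) ^ 2 -
      4 * (8 * (d₁ : ℤ_[q]) ^ 2 * (M.b₄ : ℤ_[q])) ^ 3 -
      4 * ((d₁ : ℤ_[q]) * (M.b₂ : ℤ_[q])) ^ 3 * (16 * (d₁ : ℤ_[q]) ^ 3 * (M.b₆ : ℤ_[q])) -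
      27 * (16 * (d₁ : ℤ_[q]) ^ 3 * (M.b₆ : ℤ_[q])) ^ 2 +
      18 * ((d₁ : ℤ_[q]) * (M.b₂ : ℤ_[q])) * (8 * (d₁ : ℤ_[q]) ^ 2 * (M.b₄ : ℤ_[q])) *
        (16 * (d₁ : ℤ_[q]) ^ 3 * (M.b₆ : ℤ_[q]))) ≠ 0 := by
      rw [hdisc0, residue_ne_zero_iff_isUnit]; exact hudisc
    simpa only [map_sub, map_add, map_mul, map_pow, map_ofNat] using e
  exact LocalIndex.localTamagawaNumber_baseChange_eq_one_add_card_roots N PadicInt.irreducible_p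
    s1 s2 s3 s4 s6 hdisc

omit [W.IsElliptic] hqΔ hd hWd in
/-- **Roots of the Step-6 cubic ↔ roots of the `2`-division cubic mod `q`**: under
`ℤ_q/qℤ_q ≃ ℤ/q` and `t = 4d₁x`, `P(4d₁x) = 16d₁³ψ(x)` (`cubic_rescale`; `4d₁` is a unit mod `q`),
so `#{t ∈ k : P̄(t) = 0} = #{x ∈ 𝔽_q : 4x³ + b₂x² + 2b₄x + b₆ = 0}` — Boxer–Diao 2010, proof of
Prop. 4.1: "the number of roots … of `E^{(d')}` mod `p` … is the same as the number of
`2`-torsion of `E` mod `p`". [cite: BoxerDiao2010, proof of Prop. 4.1 (p. 1977)] -/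
theorem card_roots_cubic_eq_card_filter_twoTorsion :
    (X ^ 3 + C (residue ℤ_[q] ((d₁ : ℤ_[q]) * ((integralModelInt W).b₂ : ℤ_[q]))) * X ^ 2 +
          C (residue ℤ_[q] (8 * (d₁ : ℤ_[q]) ^ 2 * ((integralModelInt W).b₄ : ℤ_[q]))) * X +
          C (residue ℤ_[q] (16 * (d₁ : ℤ_[q]) ^ 3 * ((integralModelInt W).b₆ : ℤ_[q]))) :
        (ResidueField ℤ_[q])[X]).roots.toFinset.card =
      (Finset.univ.filter fun x : ZMod q =>
        4 * x ^ 3 + ((integralModelInt W).b₂ : ZMod q) * x ^ 2 +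
          2 * ((integralModelInt W).b₄ : ZMod q) * x + ((integralModelInt W).b₆ : ZMod q) = 0).card := by
  have hqP : q.Prime := hq.out
  have hq' : Prime (q : ℤ) := Nat.prime_iff_prime_int.mp hqP
  set M := integralModelInt W with hM
  set φ : ResidueField ℤ_[q] ≃+* ZMod q := PadicInt.residueField with hφ
  set β : ℤ_[q] := (d₁ : ℤ_[q]) * (M.b₂ : ℤ_[q]) with hβ
  set δ : ℤ_[q] := 8 * (d₁ : ℤ_[q]) ^ 2 * (M.b₄ : ℤ_[q]) with hδ
  set ε : ℤ_[q] := 16 * (d₁ : ℤ_[q]) ^ 3 * (M.b₆ : ℤ_[q]) with hε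
  set f : (ResidueField ℤ_[q])[X] := X ^ 3 + C (residue ℤ_[q] β) * X ^ 2 +
    C (residue ℤ_[q] δ) * X + C (residue ℤ_[q] ε) with hf
  have hf0 : f ≠ 0 := by
    have hm : f.Monic := by rw [hf]; monicity!
    exact hm.ne_zero
  have hmem : ∀ t, t ∈ f.roots.toFinset ↔
      t ^ 3 + residue ℤ_[q] β * t ^ 2 + residue ℤ_[q] δ * t + residue ℤ_[q] ε = 0 := by
    intro t
    rw [Multiset.mem_toFinset, Polynomial.mem_roots hf0, Polynomial.IsRoot.def]
    simp [hf]
  -- the images of `β, δ, ε` in `ZMod q`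
  have hφβ : φ (residue ℤ_[q] β) = (d₁ : ZMod q) * (M.b₂ : ZMod q) := by
    simp [hβ, map_mul, map_intCast]
  have hφδ : φ (residue ℤ_[q] δ) = 8 * (d₁ : ZMod q) ^ 2 * (M.b₄ : ZMod q) := by
    simp [hδ, map_mul, map_pow, map_intCast, map_ofNat]
  have hφε : φ (residue ℤ_[q] ε) = 16 * (d₁ : ZMod q) ^ 3 * (M.b₆ : ZMod q) := by
    simp [hε, map_mul, map_pow, map_intCast, map_ofNat]
  -- `4 d₁` and `16 d₁³` are units mod `q`
  have h4d : (4 * (d₁ : ZMod q)) ≠ 0 := by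
    have h4 : ¬ (q : ℤ) ∣ 4 := fun h => by
      have : q ∣ 2 := by exact_mod_cast hq'.dvd_of_dvd_pow (show (q : ℤ) ∣ 2 ^ 2 by simpa using h)
      exact hq2 ((Nat.prime_dvd_prime_iff_eq hqP Nat.prime_two).mp this)
    have h4k : ((4 : ℤ) : ZMod q) ≠ 0 := intCast_zmod_ne_zero h4
    push_cast at h4k
    exact mul_ne_zero h4k (intCast_zmod_ne_zero hqd₁)
  have h16d : (16 * (d₁ : ZMod q) ^ 3) ≠ 0 := by
    have : (16 * (d₁ : ZMod q) ^ 3) = (4 * (d₁ : ZMod q)) ^ 2 * (d₁ : ZMod q) := by ring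
    rw [this]
    refine mul_ne_zero (pow_ne_zero _ h4d) fun h => h4d ?_
    rw [h, mul_zero]
  -- the value of `P̄` transported to `ZMod q`
  have hPφ : ∀ t : ResidueField ℤ_[q],
      φ (t ^ 3 + residue ℤ_[q] β * t ^ 2 + residue ℤ_[q] δ * t + residue ℤ_[q] ε) =
        (φ t) ^ 3 + (d₁ : ZMod q) * (M.b₂ : ZMod q) * (φ t) ^ 2 +
          8 * (d₁ : ZMod q) ^ 2 * (M.b₄ : ZMod q) * (φ t) + 16 * (d₁ : ZMod q) ^ 3 * (M.b₆ : ZMod q) := by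
    intro t
    simp only [map_add, map_mul, map_pow, hφβ, hφδ, hφε]
  refine Finset.card_nbij' (fun t => φ t * (4 * (d₁ : ZMod q))⁻¹)
    (fun x => φ.symm (4 * (d₁ : ZMod q) * x)) (fun t ht => ?_) (fun x hx => ?_) (fun t _ => ?_)
    (fun x _ => ?_)
  · -- a root `t` of `P̄` gives the root `x = φ(t)/(4d₁)` of `ψ̄`
    rw [Finset.mem_coe, hmem] at ht
    rw [Finset.mem_coe, Finset.mem_filter]
    refine ⟨Finset.mem_univ _, ?_⟩
    set x : ZMod q := φ t * (4 * (d₁ : ZMod q))⁻¹ with hx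
    have htx : φ t = 4 * (d₁ : ZMod q) * x := by
      rw [hx, mul_comm (4 * (d₁ : ZMod q)), mul_assoc, inv_mul_cancel₀ h4d, mul_one]
    have h0 := congrArg φ ht
    rw [hPφ, map_zero, htx, cubic_rescale] at h0
    exact (mul_eq_zero.mp h0).resolve_left h16d
  · -- a root `x` of `ψ̄` gives the root `t = φ⁻¹(4d₁x)` of `P̄`
    rw [Finset.mem_coe, Finset.mem_filter] at hx
    rw [Finset.mem_coe, hmem]
    apply φ.injective
    rw [hPφ, map_zero, RingEquiv.apply_symm_apply, cubic_rescale, hx.2, mul_zero]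
  · dsimp only
    rw [RingEquiv.symm_apply_eq, mul_comm, mul_assoc, inv_mul_cancel₀ h4d, mul_one]
  · dsimp only
    rw [RingEquiv.apply_symm_apply, mul_comm, ← mul_assoc, inv_mul_cancel₀ h4d, one_mul]

/-- **`c_q(Wd) = 1 + #{x ∈ 𝔽_q : 4x³ + b₂x² + 2b₄x + b₆ = 0} = #Ẽ(𝔽_q)[2]`** at a good odd prime
`q ∥ d` of the globally minimal `W` (`b_i` of its integer model), for any equation `Wd = Cd • W^{(d)}`
of the twist — Boxer–Diao 2010, proof of Prop. 4.1 (p. 1977): "`c_p` is equal to `1` plus the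
number of roots of the polynomial … mod `p`, which is the same as the number of `2`-torsion of `E`
mod `p`"; Kramer 1981, Prop. 3 (the same count as the local norm index). [cite: BoxerDiao2010, proof of Prop. 4.1 (p. 1977)]
[cite: Kramer1981, Prop. 3] -/
theorem localTamagawaNumber_padic_twist_eq_one_add_card :
    (Wd.baseChange ℚ_[q]).localTamagawaNumber ℤ_[q] =
      1 + (Finset.univ.filter fun x : ZMod q =>
        4 * x ^ 3 + ((integralModelInt W).b₂ : ZMod q) * x ^ 2 +
          2 * ((integralModelInt W).b₄ : ZMod q) * x + ((integralModelInt W).b₆ : ZMod q) = 0).card := by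
  rw [localTamagawaNumber_padic_twist_eq_one_add_card_roots W q hq2 hqΔ hd hqd₁ Cd hWd,
    card_roots_cubic_eq_card_filter_twoTorsion W q hq2 hqd₁]

end DoorPrime

/-! ### §4 The `2`-adic dictionary: `ord₂ #Ẽ(𝔽_q)[2]` from `(Δ/q)` and the parity of `a_q` -/

section Dictionary

/-- A cubic with `a ≠ 0` and non-zero discriminant is separable. [folklore] -/
private theorem separable_of_discr_ne_zero {K : Type*} [Field K] {P : Cubic K} (ha : P.a ≠ 0)
    (hd : P.discr ≠ 0) : P.toPoly.Separable := by
  have h0 : P.toPoly ≠ 0 := Cubic.ne_zero_of_a_ne_zero ha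
  have hspl : (P.toPoly.map (algebraMap K (AlgebraicClosure K))).Splits := IsAlgClosed.splits _
  have hnd : (Cubic.map (algebraMap K (AlgebraicClosure K)) P).roots.Nodup :=
    (Cubic.discr_ne_zero_iff_roots_nodup ha hspl).mp hd
  rw [Cubic.map_roots] at hnd
  exact (separable_map (algebraMap K (AlgebraicClosure K))).mp
    ((nodup_roots_iff_of_splits (Polynomial.map_ne_zero h0) hspl).mp hnd)

/-- **`#V(k)[2] = 1 + #roots(ψ) = 2ⁱ` with `i` even iff `Δ ∈ k²`, and `i ≠ 0` iff `#V(k)` is even**,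
for an elliptic curve over a finite field of odd characteristic (Kramer 1981, p. 125; the parity
clause is Lagrange/Cauchy: `V(k)` has a point of order `2` iff its order is even). Instance-free
packaging (only `Nat.card V(k)` and the root multiset appear) of the tree's
`Kramer1981.natCard_torsionBy_two_eq` / `exists_natCard_torsionBy_two_eq_two_pow`.
[cite: Kramer1981, §2 proof of Prop. 3 (p. 125)] -/
theorem exists_card_roots_add_one_eq_two_pow {k : Type*} [Field k] [Finite k]
    (V : WeierstrassCurve k) [V.IsElliptic] (h2 : (2 : k) ≠ 0) :
    ∃ i : ℕ, Multiset.card V.twoTorsionPolynomial.toPoly.roots + 1 = 2 ^ i ∧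
      (Even i ↔ IsSquare V.Δ) ∧ (i ≠ 0 ↔ Even (Nat.card V.toAffine.Point)) := by
  classical
  haveI : Finite V.toAffine.Point := by
    refine Finite.of_injective (fun P : V.toAffine.Point ↦ match P with
      | .zero => (none : Option (k × k))
      | .some x y _ => some (x, y)) ?_
    rintro (_ | ⟨x, y, h⟩) (_ | ⟨x', y', h'⟩) hPQ
    · rfl
    · simp at hPQ
    · simp at hPQ
    · simp only [Option.some.injEq, Prod.mk.injEq] at hPQ
      obtain ⟨rfl, rfl⟩ := hPQ
      rfl
  have hN := Kramer1981.natCard_torsionBy_two_eq V h2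
  obtain ⟨i, hi, hiff⟩ := Kramer1981.exists_natCard_torsionBy_two_eq_two_pow V h2
  refine ⟨i, by rw [← hN, hi], hiff, ?_⟩
  constructor
  · intro hi0
    have hdvd := AddSubgroup.card_addSubgroup_dvd_card
      (AddSubgroup.torsionBy V.toAffine.Point (2 : ℤ))
    rw [hi] at hdvd
    exact even_iff_two_dvd.mpr ((dvd_pow_self 2 hi0).trans hdvd)
  · intro hev hi0
    rw [hi0, pow_zero, AddSubgroup.card_eq_one] at hi
    -- no element of order `2`, so the order is odd
    haveI := Fintype.ofFinite V.toAffine.Point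
    haveI : Fact (Nat.Prime 2) := ⟨Nat.prime_two⟩
    have h2dvd : 2 ∣ Fintype.card V.toAffine.Point := by
      rw [← Nat.card_eq_fintype_card]; exact even_iff_two_dvd.mp hev
    obtain ⟨a, ha⟩ := exists_prime_addOrderOf_dvd_card 2 h2dvd
    have hmem : a ∈ AddSubgroup.torsionBy V.toAffine.Point (2 : ℤ) := by
      change a ∈ AddSubgroup.torsionBy V.toAffine.Point ((2 : ℕ) : ℤ)
      refine AddSubgroup.torsionBy.nsmul_iff.mpr ?_
      rw [← ha]
      exact addOrderOf_nsmul_eq_zero a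
    rw [hi, AddSubgroup.mem_bot] at hmem
    rw [hmem, addOrderOf_zero] at ha
    exact absurd ha (by norm_num)

variable (W : WeierstrassCurve ℚ) [W.IsGloballyMinimal] (q : ℕ) [hq : Fact q.Prime] (hq2 : q ≠ 2)
  (hqΔ : ¬ (q : ℤ) ∣ minimalDiscriminantInt W)

include hq2 hqΔ

/-- **The `2`-adic dictionary at a good odd prime `q`.** With `ρ = #{x ∈ 𝔽_q : 4x³ + b₂x² + 2b₄x + b₆ = 0}`
(`b_i` of the integer minimal model; `1 + ρ = #Ẽ(𝔽_q)[2] ∈ {1, 2, 4}`):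
`ord₂(1 + ρ) = [(Δ_min/q) = −1] + 2·[(Δ_min/q) = +1 ∧ a_q(W) even]` — `ρ = 1` iff `Δ_min` is a
non-square mod `q` (Kramer 1981, p. 125: "`dim E(k)₂` is even iff `Δ` becomes a square in `k`"),
and `ρ ≥ 1` iff `Ẽ(𝔽_q)` has a point of order `2` iff `#Ẽ(𝔽_q) = q + 1 − a_q` is even (`q` odd).
[cite: Kramer1981, §2 proof of Prop. 3 (p. 125)] -/
theorem padicValNat_two_one_add_card_filter_twoTorsion :
    padicValNat 2 (1 + (Finset.univ.filter fun x : ZMod q =>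
        4 * x ^ 3 + ((integralModelInt W).b₂ : ZMod q) * x ^ 2 +
          2 * ((integralModelInt W).b₄ : ZMod q) * x + ((integralModelInt W).b₆ : ZMod q) = 0).card) =
      (if jacobiSym (minimalDiscriminantInt W) q = -1 then 1 else 0) +
        (if jacobiSym (minimalDiscriminantInt W) q = 1 ∧ Even (W.frobeniusTrace q) then 2 else 0) := by
  have hqP : q.Prime := hq.out
  haveI : NeZero q := ⟨hqP.ne_zero⟩
  set M := integralModelInt W with hM
  have hΔM : minimalDiscriminantInt W = M.Δ := rfl
  set Mq : WeierstrassCurve (ZMod q) := M.map (Int.castRingHom (ZMod q)) with hMq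
  have hΔq : Mq.Δ = (M.Δ : ZMod q) := by rw [hMq, map_Δ, eq_intCast]
  have hΔq0 : ((minimalDiscriminantInt W : ℤ) : ZMod q) ≠ 0 := intCast_zmod_ne_zero hqΔ
  have hΔq0' : Mq.Δ ≠ 0 := by rw [hΔq, ← hΔM]; exact hΔq0
  haveI : Mq.IsElliptic := (WeierstrassCurve.isElliptic_iff _).mpr (Ne.isUnit hΔq0')
  have h2 : (2 : ZMod q) ≠ 0 := by
    have : ((2 : ℕ) : ZMod q) ≠ 0 := by
      rw [Ne, ZMod.natCast_eq_zero_iff]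
      intro h
      exact hq2 ((Nat.prime_dvd_prime_iff_eq hqP Nat.prime_two).mp h)
    exact_mod_cast this
  have h4 : (4 : ZMod q) ≠ 0 := by
    have : (4 : ZMod q) = 2 * 2 := by norm_num
    rw [this]; exact mul_ne_zero h2 h2
  have h16 : (16 : ZMod q) ≠ 0 := by
    have : (16 : ZMod q) = 2 ^ 4 := by norm_num
    rw [this]; exact pow_ne_zero 4 h2
  -- the `2`-division cubic of `Mq` is `ψ̄`
  have ha : Mq.twoTorsionPolynomial.a ≠ 0 := h4
  have hψ0 : Mq.twoTorsionPolynomial.toPoly ≠ 0 := Cubic.ne_zero_of_a_ne_zero ha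
  have hψ : ∀ x : ZMod q, Mq.twoTorsionPolynomial.toPoly.IsRoot x ↔
      4 * x ^ 3 + (M.b₂ : ZMod q) * x ^ 2 + 2 * (M.b₄ : ZMod q) * x + (M.b₆ : ZMod q) = 0 := by
    intro x
    simp only [WeierstrassCurve.twoTorsionPolynomial, Cubic.toPoly, hMq, map_b₂, map_b₄, map_b₆,
      eq_intCast, Polynomial.IsRoot.def, eval_add, eval_mul, eval_C, eval_pow, eval_X]
  have hS : Mq.twoTorsionPolynomial.toPoly.roots.toFinset = Finset.univ.filter fun x : ZMod q =>
      4 * x ^ 3 + (M.b₂ : ZMod q) * x ^ 2 + 2 * (M.b₄ : ZMod q) * x + (M.b₆ : ZMod q) = 0 := by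
    ext x
    rw [Multiset.mem_toFinset, Polynomial.mem_roots hψ0, hψ, Finset.mem_filter]
    simp
  have hdisc : Mq.twoTorsionPolynomial.discr ≠ 0 := by
    rw [WeierstrassCurve.twoTorsionPolynomial_discr]; exact mul_ne_zero h16 hΔq0'
  have hsep := separable_of_discr_ne_zero ha hdisc
  have hcard : (Finset.univ.filter fun x : ZMod q =>
      4 * x ^ 3 + (M.b₂ : ZMod q) * x ^ 2 + 2 * (M.b₄ : ZMod q) * x + (M.b₆ : ZMod q) = 0).card =
        Multiset.card Mq.twoTorsionPolynomial.toPoly.roots := by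
    rw [← hS, Multiset.toFinset_card_of_nodup (Polynomial.nodup_roots hsep)]
  -- Kramer: `1 + ρ = 2ⁱ`, `i` even iff `Δ` square, `i ≠ 0` iff `#Ẽ(𝔽_q)` even
  obtain ⟨i, hi, hsq, hpar⟩ := exists_card_roots_add_one_eq_two_pow Mq h2
  have hρ3 : Multiset.card Mq.twoTorsionPolynomial.toPoly.roots ≤ 3 :=
    (Polynomial.card_roots' _).trans (Cubic.natDegree_of_a_ne_zero ha).le
  have hi2 : i ≤ 2 := by
    by_contra h
    have : 2 ^ 3 ≤ 2 ^ i := Nat.pow_le_pow_right (by norm_num) (by omega)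
    omega
  rw [hcard, add_comm, hi]
  -- Legendre symbol dictionary
  have hJ : jacobiSym (minimalDiscriminantInt W) q = legendreSym q (minimalDiscriminantInt W) :=
    (jacobiSym.legendreSym.to_jacobiSym q _).symm
  have hsqΔ : IsSquare Mq.Δ ↔ IsSquare ((minimalDiscriminantInt W : ℤ) : ZMod q) := by
    rw [hΔq, ← hΔM]
  have hJ1 : jacobiSym (minimalDiscriminantInt W) q = 1 ↔ IsSquare Mq.Δ := by
    rw [hJ, legendreSym.eq_one_iff q hΔq0, hsqΔ]
  have hJm1 : jacobiSym (minimalDiscriminantInt W) q = -1 ↔ ¬ IsSquare Mq.Δ := by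
    rw [hJ, legendreSym.eq_neg_one_iff q, hsqΔ]
  -- parity dictionary
  have heven : Even (W.frobeniusTrace q) ↔ Even (Nat.card Mq.toAffine.Point) := by
    have hft : W.frobeniusTrace q = (q : ℤ) + 1 - (Nat.card Mq.toAffine.Point : ℕ) := rfl
    have hq1 : Even ((q : ℤ) + 1) := by
      obtain ⟨m, hm⟩ := hqP.odd_of_ne_two hq2
      exact ⟨m + 1, by push_cast [hm]; ring⟩
    rw [hft, Int.even_sub]
    constructor
    · intro h; exact (Int.even_coe_nat _).mp (h.mp hq1)
    · intro h; exact iff_of_true hq1 ((Int.even_coe_nat _).mpr h)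
  interval_cases i
  · -- no root: `J = 1`, `a_q` odd
    have hsq0 : IsSquare Mq.Δ := hsq.mp (by decide)
    rw [if_neg (fun h => (hJm1.mp h) hsq0), if_neg (fun h => (hpar.mpr (heven.mp h.2)) rfl)]
    simp
  · -- one root: `J = -1`
    have hsq1 : ¬ IsSquare Mq.Δ := fun h => by simpa using hsq.mpr h
    have hJv : jacobiSym (minimalDiscriminantInt W) q = -1 := hJm1.mpr hsq1
    rw [if_pos hJv, if_neg (fun h => by rw [hJv] at h; exact absurd h.1 (by norm_num))]
    simp
  · -- three roots: `J = 1`, `a_q` even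
    have hsq2 : IsSquare Mq.Δ := hsq.mp (by decide)
    have hJv : jacobiSym (minimalDiscriminantInt W) q = 1 := hJ1.mpr hsq2
    have hev : Even (W.frobeniusTrace q) := heven.mpr (hpar.mp (by norm_num))
    rw [if_neg (by rw [hJv]; norm_num), if_pos ⟨hJv, hev⟩]
    have : (2 : ℕ) ^ 2 = 2 ^ 2 := rfl
    simpa using padicValNat.prime_pow (p := 2) 2

end Dictionary

/-! ### §5 `ord₂ c_q(Wd)` at a good odd door prime `q ∥ d` -/

section Valuation

variable (W : WeierstrassCurve ℚ) [W.IsElliptic] [W.IsGloballyMinimal] (q : ℕ) [hq : Fact q.Prime]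
  (hq2 : q ≠ 2) (hqΔ : ¬ (q : ℤ) ∣ minimalDiscriminantInt W) {d : ℤ} (hqd : (q : ℤ) ∣ d)
  (hqd2 : ¬ (q : ℤ) ^ 2 ∣ d) {Wd : WeierstrassCurve ℚ} (Cd : VariableChange ℚ)
  (hWd : Cd • W.quadraticTwist (d : ℚ) = Wd)

include hq2 hqΔ hqd hqd2 hWd

/-- **`ord₂ c_q(Wd) = [(Δ_min/q) = −1] + 2·[(Δ_min/q) = +1 ∧ a_q(W) even]`** at a good odd prime
`q ∥ d`, for any equation `Wd = Cd • W^{(d)}` of the twist of the globally minimal `W` (type `I₀*`: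
`c_q = #Ẽ(𝔽_q)[2]` is `2` exactly when Frobenius at `q` acts on `E[2]` as a transposition
(`(Δ/q) = −1`), `4` exactly when it acts trivially (`(Δ/q) = 1`, `a_q` even), `1` for a `3`-cycle).
Boxer–Diao 2010, proof of Prop. 4.1; Kramer 1981, Prop. 3. Here `Δ_min = W.Δ.num`
(`W` has integer coefficients). [cite: BoxerDiao2010, proof of Prop. 4.1 (p. 1977)]
[cite: Kramer1981, Prop. 3] -/
theorem padicValNat_two_localTamagawaNumber_twist_of_dvd :
    padicValNat 2 ((Wd.baseChange ℚ_[q]).localTamagawaNumber ℤ_[q]) =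
      (if jacobiSym W.Δ.num q = -1 then 1 else 0) +
        (if jacobiSym W.Δ.num q = 1 ∧ Even (W.frobeniusTrace q) then 2 else 0) := by
  have hqP : q.Prime := hq.out
  have hq' : Prime (q : ℤ) := Nat.prime_iff_prime_int.mp hqP
  obtain ⟨d₁, hd⟩ := hqd
  have hqd₁ : ¬ (q : ℤ) ∣ d₁ := fun h => hqd2 (by rw [hd, sq]; exact mul_dvd_mul_left _ h)
  have hnum : W.Δ.num = minimalDiscriminantInt W := by
    rw [← cast_minimalDiscriminantInt W, Rat.num_intCast]
  rw [hnum, localTamagawaNumber_padic_twist_eq_one_add_card W q hq2 hqΔ hd hqd₁ Cd hWd]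
  exact padicValNat_two_one_add_card_filter_twoTorsion W q hq2 hqΔ

end Valuation

end TwistIstar

end Literature.NumberTheory.EllipticCurves

end
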